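import Summits.QuantumFields.GaugeBoot.Eqs.KZL2rpD4Z2427o1000UT1
import Summits.QuantumFields.GaugeBoot.Eqs.KZL2rpD4Z2427o1000UT2
import Summits.QuantumFields.GaugeBoot.Eqs.KZL2rpD4Z2427o1000UT3
import Summits.QuantumFields.GaugeBoot.Eqs.KZL2rpD4Z2427o1000UT4
import Summits.QuantumFields.GaugeBoot.Eqs.KZL2rpD4Z2427o1000UT5
import Summits.QuantumFields.GaugeBoot.Eqs.KZL2rpD4Z2427o1000UW1
import Summits.QuantumFields.GaugeBoot.Eqs.KZL2rpD4Z2427o1000UW2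
import HarnessLib

/-!
# Aggregated equality row of `beta-2427-1000-upper.conic1.json` — assembly of the coded row (data)

Cell `pub-gaugeboot` (HOME `run/shared/lean/pub/pub-gaugeboot/`), seat lean2 (KZ aggregated equality bindings; FANOUT-PLAN A126 (2)(c) /
A137 (1)(iii) / A146 / A152 (1)).  Certificate of record `certs/SU2-D4/kz-L2-rp/beta-2427-1000-upper.conic1.json` (sha256 field `988f10b0c074b128…`) over the
problem `certs/SU2-D4/kz-L2-rp/beta-2427-1000-upper.problem1.json` (`SU(2)`, `D = 4`, `β_std = 2427/1000`, 3300 equality rows, eng2's reduced form): its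
3300 exact equality multipliers `lamQ` (dyadic rationals; sha256 of the multiplier list `9fb0b014c58b63fd…`) contract the
equality rows into ONE row `r = Σ_e lamQ_e · row_e` (9983 labelled terms, right-hand side Σ_e lamQ_e · rhs_e = 0) — the only way
the certificate replay (lean3's `_of_feasible_agg` shape) uses the equality system.  The row is INTEGER-CODED (`Eqs/BindKitZ`: `(terms, M, K,
witness)`, terms `tz <label code> <z>` with coefficient `z / M` exactly, witness `lz <m> <def id> <position>` = an exact combination of
3300 of the family's G1 theorem rows `KZL2rpD4LitsZ*.litZ`, `μ = Σ_e lamQ_e · Λ_e` from the seat's exact elimination witnesses `Λ`,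
re-verified exactly in the seat).  Because of its size the row is spread over several modules: term pieces `…Z2427o1000UT<k>` and the
witness pieces `…Z2427o1000UW<k>` and the assembly `…Z2427o1000UR` (data only), and the final module `Eqs/KZL2rpD4Z2427o1000U` with the `m = 7` residue-class
kernel checks `chk<i>` (`Eqs/BindKitZPF.cchkZPf litZ p q 7 i` — the `BindKitZP` residue-class check with the class filter inside the combination; integer arithmetic only, one `decide` each, ≈ 21 s measured) and `Ecode`, `E_holds`, `rowSum4_row` (
`rowSum4 2427/1000 L r = 0` on every torus `(ℤ/L)^4` with `L ≥ 6`).  Positivity blocks and the certificate inequalities are NOT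
treated here.  GENERATED by `scratch/agg_data.py` + `scratch/gen_aggZP.py`.

HONEST FRAMING (page 1 of every file of this cell): certified bounds on lattice expectations at STATED coupling, gauge
group, dimension and torus size; NOT a mass gap, NOT a continuum limit, NOT a string tension, NOT large `N`; NOT
Yang–Mills-summit-bearing (barriers `FixedCouplingUltralocality`, `PerturbativeInvisibility`).
-/

noncomputable section

open Literature.MathematicalPhysics.QuantumFieldTheory
open Summit.QuantumFields.GaugeBoot.BindN Summit.QuantumFields.GaugeBoot.BindZ

namespace Summit.QuantumFields.GaugeBoot.KZL2rpD4.Z2427o1000U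

variable {L : ℕ} [NeZero L]

/-- The coded aggregated row `(terms, M, K, witness)`: 9983 terms in 5 pieces, `M = 355570991470277839506812876881920000000000000` (148 bits), `K` (18 bits) = the integer scale of the check, 3300 witness entries in 2 pieces. -/
def crow : CRowZ :=
  (terms1 ++ terms2 ++ terms3 ++ terms4 ++ terms5, 355570991470277839506812876881920000000000000,
   192000,
   wit1 ++ wit2)

end Summit.QuantumFields.GaugeBoot.KZL2rpD4.Z2427o1000U

end
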